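import Mathlib
import Literature.Analysis.Calculus.TwoVariablePartials
import Literature.Analysis.PDE.Wave1DSourceEnergy
import Literature.Analysis.PDE.Wave1DFarEnergyLimits

/-!
# Kernel-one far channels, III: the exact ray-flux identity

Helper file for `stub_kernelOneChannels` of line `crum-peeling-recessive-tower` (crux
`UniformPhotonSphereChannelsR`, stmt-FinalStateConjecture-14074).  Let `ψ` be `C²` on `ℝ²`,
solving `ψ_tt − ψ_xx + V(x)ψ = 0` on the half-plane `{x ≥ x_f}` (`V ≥ 0` continuous), with finite
initial far energy `E(0) = ∫_{x > x_f} e(0,·)`, `e = ψ_t² + ψ_x² + Vψ²`, and let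
`E(T) = ∫_{x > x_f + T} e(T,·)` (`T ≥ 0`) be the outgoing far energy.  Then:

* `continuous_residual` — the residual `ψ_tt − ψ_xx + Vψ` of a `C²` function is continuous;
* `outflux_le` / `tendsto_outflux` — the out-flux `∫_{b−T}^{b} [(ψ_t−ψ_x)² + Vψ²](b−x, x) dx`
  through the incoming characteristic from `(0, b)` is at most the initial energy on `[b − 2T, b]`
  (domain of dependence), hence tends to `0` as `b → ∞`;
* `ray_flux_identity` — the EXACT flux identity through the outgoing ray `C⁺ = {(x − x_f, x)}`:
  `∫_{x_f}^{x_f+T} [(ψ_t+ψ_x)² + Vψ²](x − x_f, x) dx = E(0) − E(T)`;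
* `ray_flux_integrableOn` — both ray densities are integrable on `(x_f, ∞)` and
  `A⁺ + B⁺ = E(0) − E⁺`, `E⁺ = lim_{T → ∞} E(T)`;
* (the strip identity `∫_0^T 2ψ_tψ_x(τ, X) dτ = ∫_{x>X} e(0,·) − ∫_{x>X} e(T,·)` built on these
  is in `…RKernelOneWedge`).
-/

noncomputable section

-- the doubled `FinalStateConjecture.FinalStateConjecture` path component trips dupNamespace
set_option linter.dupNamespace false

namespace Summit.FinalStateConjecture.FinalStateConjecture.Theorems.CrumPeelingRecessiveTower

open MeasureTheory Set Filter Topology intervalIntegral Literature.Analysis.Calculus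
open Literature.Analysis.PDE

variable {V : ℝ → ℝ} {ψ : ℝ → ℝ → ℝ}

/-- The residual `ψ_tt − ψ_xx + Vψ` of a `C²` function (`V` continuous) is jointly continuous. -/
theorem continuous_residual (hV : Continuous V) (hψ : ContDiff ℝ 2 (Function.uncurry ψ)) :
    Continuous (Function.uncurry fun t x =>
      iteratedDeriv 2 (fun τ => ψ τ x) t - iteratedDeriv 2 (ψ t) x + V x * ψ t x) := by
  obtain ⟨-, -, ψtt, -, ψxx, -, -, hctt, -, hcxx, -, -, -, -, -, -, h7, h8⟩ :=
    exists_partials_of_contDiff_two hψ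
  have : (Function.uncurry fun t x =>
      iteratedDeriv 2 (fun τ => ψ τ x) t - iteratedDeriv 2 (ψ t) x + V x * ψ t x)
      = fun p : ℝ × ℝ => ψtt p.1 p.2 - ψxx p.1 p.2 + V p.2 * ψ p.1 p.2 := by
    funext p; simp only [Function.uncurry, h7, h8]
  rw [this]
  exact (hctt.sub hcxx).add ((hV.comp continuous_snd).mul hψ.continuous)

section HalfPlane

variable {xf : ℝ} (hV : Continuous V) (hV0 : ∀ x, 0 ≤ V x) (hψ : ContDiff ℝ 2 (Function.uncurry ψ))
  (hsol : ∀ τ x, xf ≤ x →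
    iteratedDeriv 2 (fun σ => ψ σ x) τ - iteratedDeriv 2 (ψ τ) x + V x * ψ τ x = 0)
  (hfin : ∫⁻ x in Ioi xf, ENNReal.ofReal
    (deriv (fun τ => ψ τ x) 0 ^ 2 + deriv (ψ 0) x ^ 2 + V x * ψ 0 x ^ 2) < ⊤)
include hV hψ hsol

/-- **Domain of dependence for the out-flux.** For `T ≥ 0` and `x_f ≤ b − 2T`, the out-flux
`∫_{b−T}^{b} [(ψ_t−ψ_x)² + Vψ²](b−x, x) dx` through the incoming characteristic from `(0, b)` to
`(T, b − T)` lies in `[0, ∫_{b−2T}^{b} e(0,·)]` (energy identity on the triangle over `[b−2T, b]`,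
`V ≥ 0`). -/
theorem outflux_le (hV0 : ∀ x, 0 ≤ V x) {T b : ℝ} (hT : 0 ≤ T) (hb : xf ≤ b - 2 * T) :
    0 ≤ (∫ x in (b - T)..b, ((deriv (fun τ => ψ τ x) (b - x) - deriv (ψ (b - x)) x) ^ 2
        + V x * ψ (b - x) x ^ 2)) ∧
    (∫ x in (b - T)..b, ((deriv (fun τ => ψ τ x) (b - x) - deriv (ψ (b - x)) x) ^ 2
        + V x * ψ (b - x) x ^ 2))
      ≤ ∫ x in (b - 2 * T)..b,
          (deriv (fun τ => ψ τ x) 0 ^ 2 + deriv (ψ 0) x ^ 2 + V x * ψ 0 x ^ 2) := by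
  have hF := continuous_residual hV hψ
  have hid := wave1D_trapezoid_energy_identity_source hV hF hψ (fun t x => rfl)
    (a := b - 2 * T) (b := b) (s := 0) (t := T) hT (by linarith)
  have htop : (∫ x in (b - 2 * T + T)..(b - T),
      (deriv (fun τ => ψ τ x) T ^ 2 + deriv (ψ T) x ^ 2 + V x * ψ T x ^ 2)) = 0 := by
    rw [show b - 2 * T + T = b - T by ring, intervalIntegral.integral_same]
  have hsrc : (∫ τ in (0 : ℝ)..T, ∫ x in (b - 2 * T + τ)..(b - τ), deriv (fun σ => ψ σ x) τ *
      (iteratedDeriv 2 (fun σ => ψ σ x) τ - iteratedDeriv 2 (ψ τ) x + V x * ψ τ x)) = 0 := by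
    refine (intervalIntegral.integral_congr (g := fun _ => (0 : ℝ)) fun τ hτ => ?_).trans
      intervalIntegral.integral_zero
    rw [uIcc_of_le hT] at hτ
    have hle : b - 2 * T + τ ≤ b - τ := by linarith [hτ.2]
    refine (intervalIntegral.integral_congr (g := fun _ => (0 : ℝ)) fun x hx => ?_).trans
      intervalIntegral.integral_zero
    rw [uIcc_of_le hle] at hx
    simp [hsol τ x (by linarith [hx.1, hτ.1])]
  rw [htop, hsrc, mul_zero, add_zero] at hid
  simp only [add_zero, sub_zero] at hid
  have hin : 0 ≤ ∫ x in (b - 2 * T)..(b - 2 * T + T),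
      ((deriv (fun τ => ψ τ x) (x - (b - 2 * T)) + deriv (ψ (x - (b - 2 * T))) x) ^ 2
        + V x * ψ (x - (b - 2 * T)) x ^ 2) :=
    intervalIntegral.integral_nonneg (by linarith) fun x _ => by
      have := hV0 x; positivity
  have hout : 0 ≤ ∫ x in (b - T)..b, ((deriv (fun τ => ψ τ x) (b - x) - deriv (ψ (b - x)) x) ^ 2
      + V x * ψ (b - x) x ^ 2) :=
    intervalIntegral.integral_nonneg (by linarith) fun x _ => by
      have := hV0 x; positivity
  exact ⟨hout, by linarith⟩

include hV0 hfin

/-- The energy densities at every time `T ≥ 0` are integrable on `(x_f + T, ∞)`. -/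
theorem integrableOn_energy {T : ℝ} (hT : 0 ≤ T) :
    IntegrableOn (fun x => deriv (fun τ => ψ τ x) T ^ 2 + deriv (ψ T) x ^ 2 + V x * ψ T x ^ 2)
      (Ioi (xf + T)) := by
  have h := (wave1D_farEnergy_integrableOn hV hV0 (continuous_residual hV hψ) hψ
    (fun t x => rfl) hsol hfin T).1
  rwa [abs_of_nonneg hT] at h

/-- The initial energy density is integrable on `(x_f, ∞)`. -/
theorem integrableOn_energy_zero :
    IntegrableOn (fun x => deriv (fun τ => ψ τ x) 0 ^ 2 + deriv (ψ 0) x ^ 2 + V x * ψ 0 x ^ 2)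
      (Ioi xf) := by
  simpa using integrableOn_energy hV hV0 hψ hsol hfin le_rfl

/-- **The out-flux tends to zero** as the base point `b → ∞` (`T ≥ 0` fixed). -/
theorem tendsto_outflux {T : ℝ} (hT : 0 ≤ T) :
    Tendsto (fun b => ∫ x in (b - T)..b,
      ((deriv (fun τ => ψ τ x) (b - x) - deriv (ψ (b - x)) x) ^ 2 + V x * ψ (b - x) x ^ 2))
      atTop (𝓝 0) := by
  set e0 : ℝ → ℝ := fun x => deriv (fun τ => ψ τ x) 0 ^ 2 + deriv (ψ 0) x ^ 2 + V x * ψ 0 x ^ 2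
    with he0
  have he0c : Continuous e0 :=
    (continuous_wave1D_energyDensity hV hψ).comp (continuous_const.prodMk continuous_id)
  have hint := integrableOn_energy_zero hV hV0 hψ hsol hfin
  have hG : Tendsto (fun b => ∫ x in xf..b, e0 x) atTop (𝓝 (∫ x in Ioi xf, e0 x)) :=
    intervalIntegral_tendsto_integral_Ioi xf hint tendsto_id
  have hG2 : Tendsto (fun b => ∫ x in xf..(b - 2 * T), e0 x) atTop (𝓝 (∫ x in Ioi xf, e0 x)) :=
    intervalIntegral_tendsto_integral_Ioi xf hint (tendsto_atTop_add_const_right _ _ tendsto_id)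
  have hH : Tendsto (fun b => ∫ x in (b - 2 * T)..b, e0 x) atTop (𝓝 0) := by
    have h := hG.sub hG2
    rw [sub_self] at h
    refine h.congr fun b => ?_
    rw [← integral_add_adjacent_intervals (he0c.intervalIntegrable xf (b - 2 * T))
      (he0c.intervalIntegrable (b - 2 * T) b)]
    ring
  refine squeeze_zero' ?_ ?_ hH
  · filter_upwards [eventually_ge_atTop (xf + 2 * T)] with b hb
    exact (outflux_le hV hψ hsol hV0 hT (by linarith)).1
  · filter_upwards [eventually_ge_atTop (xf + 2 * T)] with b hb
    exact (outflux_le hV hψ hsol hV0 hT (by linarith)).2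

/-- **The exact ray-flux identity.** For `T ≥ 0`: the flux through the outgoing ray
`C⁺ = {(x − x_f, x) : x_f ≤ x ≤ x_f + T}` accounts for all the far energy lost between times `0`
and `T`: `∫_{x_f}^{x_f+T} [(ψ_t+ψ_x)² + Vψ²](x − x_f, x) dx = E(0) − E(T)` (no energy leaks to
spatial infinity in finite time). -/
theorem ray_flux_identity {T : ℝ} (hT : 0 ≤ T) :
    (∫ x in xf..(xf + T), ((deriv (fun τ => ψ τ x) (x - xf) + deriv (ψ (x - xf)) x) ^ 2
        + V x * ψ (x - xf) x ^ 2))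
      = (∫ x in Ioi xf, (deriv (fun τ => ψ τ x) 0 ^ 2 + deriv (ψ 0) x ^ 2 + V x * ψ 0 x ^ 2))
        - ∫ x in Ioi (xf + T),
            (deriv (fun τ => ψ τ x) T ^ 2 + deriv (ψ T) x ^ 2 + V x * ψ T x ^ 2) := by
  set e0 : ℝ → ℝ := fun x => deriv (fun τ => ψ τ x) 0 ^ 2 + deriv (ψ 0) x ^ 2 + V x * ψ 0 x ^ 2
    with he0
  set eT : ℝ → ℝ := fun x => deriv (fun τ => ψ τ x) T ^ 2 + deriv (ψ T) x ^ 2 + V x * ψ T x ^ 2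
    with heT
  set R : ℝ := ∫ x in xf..(xf + T), ((deriv (fun τ => ψ τ x) (x - xf) + deriv (ψ (x - xf)) x) ^ 2
    + V x * ψ (x - xf) x ^ 2) with hR
  set out : ℝ → ℝ := fun b => ∫ x in (b - T)..b,
    ((deriv (fun τ => ψ τ x) (b - x) - deriv (ψ (b - x)) x) ^ 2 + V x * ψ (b - x) x ^ 2) with hout
  have hF := continuous_residual hV hψ
  -- the trapezoid identity over `[xf, b]`, source-free
  have hid : ∀ b, xf + T ≤ b - T →
      (∫ x in (xf + T)..(b - T), eT x) - (∫ x in xf..b, e0 x) = -R - out b := by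
    intro b hb
    have h := wave1D_trapezoid_energy_identity_source hV hF hψ (fun t x => rfl)
      (a := xf) (b := b) (s := 0) (t := T) hT hb
    have hsrc : (∫ τ in (0 : ℝ)..T, ∫ x in (xf + τ)..(b - τ), deriv (fun σ => ψ σ x) τ *
        (iteratedDeriv 2 (fun σ => ψ σ x) τ - iteratedDeriv 2 (ψ τ) x + V x * ψ τ x)) = 0 := by
      refine (intervalIntegral.integral_congr (g := fun _ => (0 : ℝ)) fun τ hτ => ?_).trans
        intervalIntegral.integral_zero
      rw [uIcc_of_le hT] at hτ
      have hle : xf + τ ≤ b - τ := by linarith [hτ.2]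
      refine (intervalIntegral.integral_congr (g := fun _ => (0 : ℝ)) fun x hx => ?_).trans
        intervalIntegral.integral_zero
      rw [uIcc_of_le hle] at hx
      simp [hsol τ x (by linarith [hx.1, hτ.1])]
    rw [hsrc, mul_zero, add_zero] at h
    simp only [add_zero, sub_zero] at h
    exact h
  -- limits as `b → ∞`
  have hintT := integrableOn_energy hV hV0 hψ hsol hfin hT
  have hint0 := integrableOn_energy_zero hV hV0 hψ hsol hfin
  have hF1 : Tendsto (fun b => ∫ x in (xf + T)..(b - T), eT x) atTop (𝓝 (∫ x in Ioi (xf + T), eT x)) :=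
    intervalIntegral_tendsto_integral_Ioi (xf + T) hintT (tendsto_atTop_add_const_right _ _ tendsto_id)
  have hF2 : Tendsto (fun b => ∫ x in xf..b, e0 x) atTop (𝓝 (∫ x in Ioi xf, e0 x)) :=
    intervalIntegral_tendsto_integral_Ioi xf hint0 tendsto_id
  have hF3 : Tendsto (fun b => -R - out b) atTop (𝓝 (-R - 0)) :=
    tendsto_const_nhds.sub (tendsto_outflux hV hV0 hψ hsol hfin hT)
  have hlim : Tendsto (fun b => (∫ x in (xf + T)..(b - T), eT x) - ∫ x in xf..b, e0 x) atTop
      (𝓝 (-R - 0)) := by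
    refine hF3.congr' ?_
    filter_upwards [eventually_ge_atTop (xf + 2 * T)] with b hb
    exact (hid b (by linarith)).symm
  have huniq := tendsto_nhds_unique (hF1.sub hF2) hlim
  linarith

/-- **Integrability of the ray densities and the total ray flux.** Both ray densities
`(ψ_t+ψ_x)²(x − x_f, x)` and `V(x)ψ(x − x_f, x)²` are integrable on `(x_f, ∞)`, and if the far
energy `E(t) = ∫_{x > x_f + |t|} e(t,·)` tends to `E⁺` as `t → +∞` then
`∫_{x_f}^∞ (ψ_t+ψ_x)²|_{C⁺} + ∫_{x_f}^∞ Vψ²|_{C⁺} = E(0) − E⁺`. -/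
theorem ray_flux_integrableOn {Lp : ℝ}
    (hLp : Tendsto (fun t => ∫ x in Ioi (xf + |t|),
      (deriv (fun τ => ψ τ x) t ^ 2 + deriv (ψ t) x ^ 2 + V x * ψ t x ^ 2)) atTop (𝓝 Lp)) :
    IntegrableOn (fun x => (deriv (fun τ => ψ τ x) (x - xf) + deriv (ψ (x - xf)) x) ^ 2) (Ioi xf) ∧
    IntegrableOn (fun x => V x * ψ (x - xf) x ^ 2) (Ioi xf) ∧
    (∫ x in Ioi xf, (deriv (fun τ => ψ τ x) (x - xf) + deriv (ψ (x - xf)) x) ^ 2)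
      + (∫ x in Ioi xf, V x * ψ (x - xf) x ^ 2)
      = (∫ x in Ioi xf, (deriv (fun τ => ψ τ x) 0 ^ 2 + deriv (ψ 0) x ^ 2 + V x * ψ 0 x ^ 2))
        - Lp := by
  obtain ⟨ψt, ψx, -, -, -, hct, hcx, -, -, -, h1, h2, -⟩ := exists_partials_of_contDiff_two hψ
  have hd1 : ∀ t x, deriv (fun τ => ψ τ x) t = ψt t x := fun t x => (h1 t x).deriv
  have hd2 : ∀ t x, deriv (ψ t) x = ψx t x := fun t x => (h2 t x).deriv
  set rA : ℝ → ℝ := fun x => (deriv (fun τ => ψ τ x) (x - xf) + deriv (ψ (x - xf)) x) ^ 2 with hrA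
  set rB : ℝ → ℝ := fun x => V x * ψ (x - xf) x ^ 2 with hrB
  set E0 : ℝ := ∫ x in Ioi xf, (deriv (fun τ => ψ τ x) 0 ^ 2 + deriv (ψ 0) x ^ 2 + V x * ψ 0 x ^ 2)
    with hE0
  have hray : Continuous fun x : ℝ => ((x - xf, x) : ℝ × ℝ) :=
    (continuous_id.sub continuous_const).prodMk continuous_id
  have hrAc : Continuous rA := by
    have : rA = fun x => (ψt (x - xf) x + ψx (x - xf) x) ^ 2 := by
      funext x; simp only [hrA, hd1, hd2]
    rw [this]
    exact ((hct.comp hray).add (hcx.comp hray)).pow 2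
  have hrBc : Continuous rB := hV.mul ((hψ.continuous.comp hray).pow 2)
  have hrA0 : ∀ x, 0 ≤ rA x := fun x => sq_nonneg _
  have hrB0 : ∀ x, 0 ≤ rB x := fun x => mul_nonneg (hV0 x) (sq_nonneg _)
  -- the truncated ray fluxes
  have hE0nn : ∀ T, 0 ≤ T → 0 ≤ ∫ x in Ioi (xf + T),
      (deriv (fun τ => ψ τ x) T ^ 2 + deriv (ψ T) x ^ 2 + V x * ψ T x ^ 2) := fun T _ =>
    setIntegral_nonneg measurableSet_Ioi fun x _ => wave1D_energyDensity_nonneg hV0 T x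
  have hbound : ∀ X, xf ≤ X → (∫ x in xf..X, (rA x + rB x)) ≤ E0 := by
    intro X hX
    have h := ray_flux_identity hV hV0 hψ hsol hfin (T := X - xf) (by linarith)
    rw [show xf + (X - xf) = X by ring] at h
    have h0 := hE0nn (X - xf) (by linarith)
    rw [show xf + (X - xf) = X by ring] at h0
    simp only [hrA, hrB]
    linarith
  have hsum_c : Continuous fun x => rA x + rB x := hrAc.add hrBc
  have hint : IntegrableOn (fun x => rA x + rB x) (Ioi xf) := by
    refine integrableOn_Ioi_of_intervalIntegral_norm_bounded E0 xf (l := atTop) (b := id)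
      (fun X => (hsum_c.integrableOn_Icc).mono_set Ioc_subset_Icc_self) tendsto_id ?_
    filter_upwards [eventually_ge_atTop xf] with X hX
    have : ∫ x in xf..id X, ‖rA x + rB x‖ = ∫ x in xf..X, (rA x + rB x) :=
      intervalIntegral.integral_congr fun x _ => by
        rw [Real.norm_eq_abs, abs_of_nonneg (add_nonneg (hrA0 x) (hrB0 x))]
    rw [this]; exact hbound X hX
  have hiA : IntegrableOn rA (Ioi xf) :=
    Integrable.mono' hint hrAc.aestronglyMeasurable (ae_of_all _ fun x => by
      rw [Real.norm_eq_abs, abs_of_nonneg (hrA0 x)]; linarith [hrB0 x])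
  have hiB : IntegrableOn rB (Ioi xf) :=
    Integrable.mono' hint hrBc.aestronglyMeasurable (ae_of_all _ fun x => by
      rw [Real.norm_eq_abs, abs_of_nonneg (hrB0 x)]; linarith [hrA0 x])
  refine ⟨hiA, hiB, ?_⟩
  -- the value of the total flux
  have hlim1 : Tendsto (fun X => ∫ x in xf..X, (rA x + rB x)) atTop
      (𝓝 (∫ x in Ioi xf, (rA x + rB x))) :=
    intervalIntegral_tendsto_integral_Ioi xf hint tendsto_id
  have hLp' : Tendsto (fun X => ∫ x in Ioi (xf + (X - xf)),
      (deriv (fun τ => ψ τ x) (X - xf) ^ 2 + deriv (ψ (X - xf)) x ^ 2 + V x * ψ (X - xf) x ^ 2))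
      atTop (𝓝 Lp) := by
    have h := hLp.comp (tendsto_atTop_add_const_right _ (-xf) tendsto_id)
    refine h.congr' ?_
    filter_upwards [eventually_ge_atTop xf] with X hX
    simp only [Function.comp, id_eq, ← sub_eq_add_neg, abs_of_nonneg (sub_nonneg.2 hX)]
  have hlim2 : Tendsto (fun X => ∫ x in xf..X, (rA x + rB x)) atTop (𝓝 (E0 - Lp)) := by
    refine (tendsto_const_nhds.sub hLp').congr' ?_
    filter_upwards [eventually_ge_atTop xf] with X hX
    have h := ray_flux_identity hV hV0 hψ hsol hfin (T := X - xf) (by linarith)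
    rw [show xf + (X - xf) = X by ring] at h ⊢
    simp only [hrA, hrB]
    rw [h]
  have huniq := tendsto_nhds_unique hlim1 hlim2
  rw [← huniq]
  exact (integral_add hiA hiB).symm

end HalfPlane

/-- Registered form of `ray_flux_identity` (sub-goal `stub_kernelOneRayFlux` of the crux item). -/
theorem stub_kernelOneRayFlux : ∀ (V : ℝ → ℝ) (ψ : ℝ → ℝ → ℝ) (xf : ℝ), Continuous V →
    (∀ x, 0 ≤ V x) → ContDiff ℝ 2 (Function.uncurry ψ) → (∀ τ x, xf ≤ x →
      iteratedDeriv 2 (fun σ => ψ σ x) τ - iteratedDeriv 2 (ψ τ) x + V x * ψ τ x = 0) →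
    (∫⁻ x in Set.Ioi xf, ENNReal.ofReal
      (deriv (fun τ => ψ τ x) 0 ^ 2 + deriv (ψ 0) x ^ 2 + V x * ψ 0 x ^ 2)) < ⊤ →
    ∀ T : ℝ, 0 ≤ T → (∫ x in xf..(xf + T), ((deriv (fun τ => ψ τ x) (x - xf)
      + deriv (ψ (x - xf)) x) ^ 2 + V x * ψ (x - xf) x ^ 2))
      = (∫ x in Set.Ioi xf, (deriv (fun τ => ψ τ x) 0 ^ 2 + deriv (ψ 0) x ^ 2 + V x * ψ 0 x ^ 2))
        - ∫ x in Set.Ioi (xf + T),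
            (deriv (fun τ => ψ τ x) T ^ 2 + deriv (ψ T) x ^ 2 + V x * ψ T x ^ 2) :=
  fun _ _ _ hV hV0 hψ hsol hfin _ hT => ray_flux_identity hV hV0 hψ hsol hfin hT

end Summit.FinalStateConjecture.FinalStateConjecture.Theorems.CrumPeelingRecessiveTower
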